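import Summits.BirchSwinnertonDyer.Rank1Residual.Additive.GordHigherOrdinaryPoint
import Summits.BirchSwinnertonDyer.Rank1Residual.Additive.SpecialJSupersingular
import Mathlib.FieldTheory.IntermediateField.Adjoin.Basic
import Mathlib.RingTheory.Finiteness.Cardinality
import HarnessLib

/-!
# A SUPERSINGULAR good model (`j̃ ∈ {0, 1728}`, `p ≢ 1 (mod 3)` resp. `(mod 4)`): every `p`-power
# torsion point reduces to `Õ` — row T-CG-SS addendum A2, file A2a (cell `b2b-bsdres`, team n1011; seat n1011-p05 gen 8)

HONEST FRAMING (cell `b2b-bsdres`, run/shared/lean/b2b/bsd-rank1-residual/, verbatim in every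
file): the goal of the cell is to DELETE the COMBINATION-SHAPED residual classes of the
Birch–Swinnerton-Dyer formula for ALL analytic-rank `≤ 1` elliptic curves over `ℚ` — "full BSD
formula for every rank `≤ 1` curve in class `C`" assembled STRICTLY from published theorems — so
that the rank-`≤ 1` remainder becomes exactly the CONSTRUCTION-SHAPED classes, which are TYPED
(missing-input `Prop`s), NOT attempted. This is not "finishing BSD". Team n1011 (X4 ∧ `p = 3`,
§I N10/N11; the O5 cell `(t′)` of RESIDUAL-MAP §I): research route; prove what is provable now; no
claim beyond stated classes; census output = EVIDENCE, never a Literature fact; RESIDUAL-MAP marks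
UNCHANGED; nothing is booked by this file. TOOL theorems only: NO definition, NO named fact, NO
conjecture node.

## What and why

This is the SUPERSINGULAR twin of row T-ROL-G's file F-B (`GordHigherOrdinaryPoint.lean`). There,
for a good model `W₀` over the valuation ring `𝒪_w` of `K̄_v` whose reduced curve has `j̃ = 0` and
`3 ∣ p − 1` (or `j̃ = 1728` and `4 ∣ p − 1`), an ORDINARY point was produced (some `p`-torsion
point with non-zero reduction). Here, on the complementary congruence classes `3 ∤ p − 1` resp.
`4 ∤ p − 1` — the census cell `(t′)` of O5 (`e ∤ p − 1`), Kodaira `IV, IV*, II, II*` (`e ∈ {3, 6}`,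
`j̃ = 0`) and `III, III*` (`e = 4`, `j̃ = 1728`) — the reduced curve is SUPERSINGULAR and we prove
that EVERY `p`-power torsion point of `W₀(L)` reduces to `Õ`, which is VERBATIM the hypothesis
`htors` of S1 `GoodModelNoLocalCondition.not_isTorsion_of_torsion_mem_kernel` (Greenberg, LNM 1716
Thm. 1.7 at a potentially supersingular prime, mod the Coates–Greenberg record). Addendum A1
(`GoodModelOrdinarySemistabilityIndex`) had reached the `p`-torsion statement by contraposition
("an ordinary point forces `e ∣ p − 1`") and LOCATED the `p^k`-gap; the present route needs no
division or lifting in `Ŵ₀(𝔪̄)`: the reduced curve simply has no point of order `p` over `k̄`.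

* §1 (over an algebraically closed field `k` of characteristic `p`, `p ≥ 5`)
  `baseChange_eq_zero_of_zsmul_eq_zero_of_forall_dvd_trace` — **supersingularity is a property of
  `j` over `k̄`, by finite subfields**: if `E₁/𝔽_p` satisfies `p ∣ #K₀ + 1 − #E₁(K₀)` for EVERY
  finite subfield `K₀ ⊂ k`, then `E₁(k)` has no point of order `p`: such a point `(x, y)` has
  `ψ_p²(x) = 0` with `ψ_p² ≠ 0` (F-B `natDegree_ΨSq_ne_zero_of_exists_torsion`, *AEC* Ex. 3.7 +
  III.6.4(b)), so `x` is algebraic over `𝔽_p`, `y` is integral over `𝔽_p(x)`, and `(x, y)` is a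
  point of order `p` of `E₁(K₀)`, `K₀ = 𝔽_p(x, y)` FINITE — against `p ∣ #K₀`, `p ∣ #E₁(K₀)`,
  `p ∣ #K₀ + 1 − #E₁(K₀)`. Instances `eq_zero_of_zsmul_eq_zero_of_j_eq_zero` (`3 ∤ p − 1`) and
  `eq_zero_of_zsmul_eq_zero_of_j_eq_1728` (`4 ∤ p − 1`) from additive-p2's Deuring converse
  `SpecialJ.dvd_trace_of_j_eq_zero_of_ringChar_eq` / `…_of_j_eq_of_ringChar_eq` (over EVERY finite
  field of characteristic `p`; *AEC* V.4.1(a), Ex. V.4.4/V.4.5) applied to Mathlib's `ofJ 0` /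
  `ofJ 1728` and transported along `E₁ ⊗ k ≅ V` (Mathlib `exists_variableChange_of_j_eq`,
  *AEC* III.1.4(b)).
* §2 (`M` with unit discriminant over a local ring `O` of integers of a valued field `L`
  (`hv : v.Integers O`, as in the tree's `goodReductionHom`), residue characteristic `p`) `goodReductionHom_eq_zero_of_pow_smul_eq_zero_of_forall_map` — if the reduced curve has no
  point of order `p` over `k̄ = AlgebraicClosure (ResidueField O)`, then `red P = Õ` for every `P`
  with `p^n • P = O` (`red P` is `p^n`-torsion in `M̃(k_w) ↪ M̃(k̄)`, which has no `p`-power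
  torsion); **`goodReductionHom_eq_zero_of_pow_smul_eq_zero_of_residue_c₄_eq_zero`**
  (`j̃ = 0 ⟺ c̃₄ = 0`, `3 ∤ p − 1`, `p ≥ 5`) and **`…_of_residue_c₆_eq_zero`** (`j̃ = 1728 ⟺ c̃₆ = 0`,
  `4 ∤ p − 1`, `p ≥ 5`) — hypotheses instance-free, conclusion = S1's `htors` shape
  (`goodReductionHom_eq_zero_iff` / `mem_kernelOfReduction_iff`).

Binder honesty: no class predicate, no curve over `ℚ`, no named fact; the residue characteristic
enters as `[CharP (IsLocalRing.ResidueField O) p]`. NOT claimed: `p = 3` (where `j̃ = 1728` IS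
supersingular but the cell's Kummer–Deuring good model is built for `p ≥ 5` only), `p = 2`. The
class-level consequence (`SubTprime → ¬ D.IsTorsion`, Thm. 1.7 on all of O5 at `p ≥ 5`) is file A2b
`PotSupersingularTprimeNotCotorsion.lean`.

References: J. H. Silverman, *AEC* 2nd ed. III.1.4(b), III.6.4(b), Ex. 3.7, V.3.1(a), V.4.1(a),
Ex. V.4.4–4.5, VII.2.1 [SilvermanAEC2009]; L. C. Washington, *Elliptic Curves* (2nd ed.) §4.6
Prop. 4.31; M. Deuring, Abh. Math. Sem. Hamburg 14 (1941); R. Greenberg, LNM 1716 Thm. 1.7 (p. 61)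
and §2 p. 83 [GreenbergLNM1716]; cells/n1011/skel/T-CG-SS-A2.md (03e9e29809820b08); additive-p2
`Additive/SpecialJSupersingular.lean`; F-B `Additive/GordHigherOrdinaryPoint.lean`.
-/

noncomputable section

open scoped Classical

open Polynomial WeierstrassCurve

universe u

namespace Summit.BirchSwinnertonDyer.Rank1Residual.Additive.GoodModelLine

open Literature.NumberTheory.EllipticCurves

/-! ## §0 No `p`-torsion ⇒ no `p`-power torsion -/

/-- In an additive group without elements of order `p`, `p^n • a = 0` forces `a = 0`. [folklore] -/
theorem eq_zero_of_pow_nsmul_eq_zero_of_forall {A : Type*} [AddCommGroup A] {p : ℕ}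
    (h : ∀ a : A, (p : ℤ) • a = 0 → a = 0) {n : ℕ} {a : A} (ha : p ^ n • a = 0) : a = 0 := by
  induction n generalizing a with
  | zero => simpa using ha
  | succ n ih =>
    rw [pow_succ, mul_smul] at ha
    exact h a (by rw [natCast_zsmul]; exact ih ha)

/-! ## §1 Supersingularity is a property of `j` over an algebraically closed field: no point of
order `p` -/

section AlgClosed

variable (p : ℕ) [hp : Fact p.Prime] {k : Type u} [Field k] [IsAlgClosed k]

/-- **No point of order `p` over `k̄`, by finite subfields.** Let `E₁/𝔽_p` be an elliptic curve
such that `p ∣ #K₀ + 1 − #E₁(K₀)` for every FINITE subfield `K₀` of the algebraically closed field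
`k ⊇ 𝔽_p` (SUPERSINGULAR at every finite level). Then `E₁(k)` has no point of order `p`: a point
`(x, y)` of order `p` has `ψ_p²(x) = 0` (*AEC* Ex. 3.7) with `ψ_p² ≠ 0` (F-B
`natDegree_ΨSq_ne_zero_of_exists_torsion`), so `x` is algebraic over `𝔽_p`; `y` is integral over
`𝔽_p(x)` (the Weierstrass equation is monic quadratic in `y`); hence `K₀ = 𝔽_p(x, y)` is a finite
field and `(x, y) ∈ E₁(K₀)` has order `p`, so `p ∣ #E₁(K₀)`; with `p ∣ #K₀` this contradicts
`p ∣ #K₀ + 1 − #E₁(K₀)`. (Silverman *AEC* V.3.1(a): supersingular ⟺ `E[p] = 0`.)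
[cite: SilvermanAEC2009, Thm. V.3.1(a) and Exercise 3.7] -/
theorem baseChange_eq_zero_of_zsmul_eq_zero_of_forall_dvd_trace [Algebra (ZMod p) k]
    (E₁ : WeierstrassCurve (ZMod p)) [E₁.IsElliptic]
    (hss : ∀ (K₀ : IntermediateField (ZMod p) k) [Finite K₀],
      (p : ℤ) ∣ (Nat.card K₀ : ℤ) + 1 - Nat.card (E₁.baseChange K₀).toAffine.Point)
    (Q : (E₁.baseChange k).toAffine.Point) (hQ : (p : ℤ) • Q = 0) : Q = 0 := by
  haveI : CharP k p := (Algebra.charP_iff (ZMod p) k p).mp inferInstance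
  by_contra hQ0
  rcases Q with _ | ⟨x, y, hxy⟩
  · exact hQ0 rfl
  -- `ψ_p²(E₁ ⊗ k) ≠ 0` and `ψ_p²(x) = 0`
  have hΨne : (E₁.baseChange k).ΨSq p ≠ 0 := fun h0 ↦
    natDegree_ΨSq_ne_zero_of_exists_torsion (E₁.baseChange k) p ⟨_, hQ0, hQ⟩
      (by rw [h0, natDegree_zero])
  have hΨx : ((E₁.baseChange k).ΨSq p).eval x = 0 :=
    (zsmul_some_eq_zero_iff_eval_ΨSq (E₁.baseChange k) hxy p).mp hQ
  -- `x` is algebraic over `𝔽_p`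
  have hx : IsIntegral (ZMod p) x := by
    refine IsAlgebraic.isIntegral ⟨E₁.ΨSq p, fun h0 ↦ hΨne ?_, ?_⟩
    · rw [baseChange, map_ΨSq, h0, Polynomial.map_zero]
    · rw [Polynomial.aeval_def, ← Polynomial.eval_map, ← map_ΨSq]
      exact hΨx
  -- `y` is integral over `𝔽_p(x)`, hence over `𝔽_p`
  have hy : IsIntegral (ZMod p) y := by
    set Fx : IntermediateField (ZMod p) k := IntermediateField.adjoin (ZMod p) {x} with hFx
    haveI : FiniteDimensional (ZMod p) Fx := IntermediateField.adjoin.finiteDimensional hx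
    have hxF : x ∈ Fx := IntermediateField.mem_adjoin_simple_self (ZMod p) x
    have ha : ∀ a : ZMod p, algebraMap (ZMod p) k a ∈ Fx := fun a ↦ Fx.algebraMap_mem a
    have hc₁ : (E₁.baseChange k).a₁ * x + (E₁.baseChange k).a₃ ∈ Fx :=
      Fx.add_mem (Fx.mul_mem (ha _) hxF) (ha _)
    have hc₀ : x ^ 3 + (E₁.baseChange k).a₂ * x ^ 2 + (E₁.baseChange k).a₄ * x +
        (E₁.baseChange k).a₆ ∈ Fx :=
      Fx.add_mem (Fx.add_mem (Fx.add_mem (pow_mem hxF 3) (Fx.mul_mem (ha _) (pow_mem hxF 2)))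
        (Fx.mul_mem (ha _) hxF)) (ha _)
    set c₁ : Fx := ⟨_, hc₁⟩ with hc₁def
    set c₀ : Fx := ⟨_, hc₀⟩ with hc₀def
    have hlt2 : (C c₁ * X - C c₀).degree < ((2 : ℕ) : WithBot ℕ) :=
      (degree_sub_le _ _).trans_lt
        (max_lt ((degree_C_mul_X_le _).trans_lt (by decide)) (degree_C_le.trans_lt (by decide)))
    have hqm : (X ^ 2 + (C c₁ * X - C c₀) : Fx[X]).Monic := monic_X_pow_add hlt2
    have heq : y ^ 2 + ((E₁.baseChange k).a₁ * x + (E₁.baseChange k).a₃) * y -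
        (x ^ 3 + (E₁.baseChange k).a₂ * x ^ 2 + (E₁.baseChange k).a₄ * x + (E₁.baseChange k).a₆) = 0 := by
      have h := (Affine.equation_iff _ _).mp hxy.left
      linear_combination h
    have hyFx : IsIntegral Fx y := by
      refine ⟨X ^ 2 + (C c₁ * X - C c₀), hqm, ?_⟩
      simp only [eval₂_add, eval₂_sub, eval₂_mul, eval₂_pow, eval₂_X, eval₂_C]
      change y ^ 2 + (((E₁.baseChange k).a₁ * x + (E₁.baseChange k).a₃) * y -
        (x ^ 3 + (E₁.baseChange k).a₂ * x ^ 2 + (E₁.baseChange k).a₄ * x + (E₁.baseChange k).a₆)) = 0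
      linear_combination heq
    exact isIntegral_trans y hyFx
  -- the FINITE field `K₀ = 𝔽_p(x, y)`
  set K₀ : IntermediateField (ZMod p) k := IntermediateField.adjoin (ZMod p) {x, y} with hK₀
  haveI : FiniteDimensional (ZMod p) K₀ :=
    IntermediateField.finiteDimensional_adjoin (by
      rintro z hz
      rcases hz with rfl | hz
      · exact hx
      · rw [Set.mem_singleton_iff] at hz
        rw [hz]; exact hy)
  haveI : Finite K₀ := Module.finite_of_finite (ZMod p)
  haveI : CharP K₀ p := (Algebra.charP_iff (ZMod p) K₀ p).mp inferInstance
  have hxK : x ∈ K₀ := IntermediateField.subset_adjoin _ _ (Set.mem_insert _ _)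
  have hyK : y ∈ K₀ := IntermediateField.subset_adjoin _ _ (Set.mem_insert_of_mem _ rfl)
  -- the `K₀`-point `(x, y)`, of order `p`
  set ι : K₀ →ₐ[ZMod p] k := K₀.val with hι
  have hns₀ : (E₁.baseChange K₀).toAffine.Nonsingular (⟨x, hxK⟩ : K₀) ⟨y, hyK⟩ :=
    (Affine.baseChange_nonsingular (W := E₁.toAffine) (f := ι) ι.injective _ _).mp hxy
  set P₀ : (E₁.baseChange K₀).toAffine.Point := .some _ _ hns₀ with hP₀
  have hmap : Affine.Point.map (W' := E₁.toAffine) ι P₀ = .some _ _ hxy := rfl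
  have hP₀p : (p : ℤ) • P₀ = 0 := by
    apply Affine.Point.map_injective (W' := E₁.toAffine) ι
    rw [map_zsmul, map_zero, hmap]
    exact hQ
  have hP₀0 : P₀ ≠ 0 := Affine.Point.some_ne_zero hns₀
  have hord : addOrderOf P₀ = p := addOrderOf_eq_prime (by rw [← natCast_zsmul]; exact hP₀p) hP₀0
  have hE : (p : ℤ) ∣ (Nat.card (E₁.baseChange K₀).toAffine.Point : ℤ) := by
    have h := addOrderOf_dvd_natCard P₀
    rw [hord] at h
    exact_mod_cast h
  -- `p ∣ #K₀`
  have hK : (p : ℤ) ∣ (Nat.card K₀ : ℤ) := by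
    haveI := Fintype.ofFinite K₀
    obtain ⟨n, -, hn⟩ := FiniteField.card K₀ p
    rw [Nat.card_eq_fintype_card, hn]
    push_cast
    exact dvd_pow_self _ n.ne_zero
  -- contradiction with `p ∣ #K₀ + 1 − #E₁(K₀)`
  have h1 : (p : ℤ) ∣ 1 := by
    have h := hss K₀
    have : (1 : ℤ) = ((Nat.card K₀ : ℤ) + 1 - Nat.card (E₁.baseChange K₀).toAffine.Point) -
        Nat.card K₀ + Nat.card (E₁.baseChange K₀).toAffine.Point := by ring
    rw [this]
    exact dvd_add (dvd_sub h hK) hE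
  have hp1 : (p : ℤ) = 1 := Int.eq_one_of_dvd_one (by positivity) h1
  exact hp.out.one_lt.ne' (by exact_mod_cast hp1)

/-- **Supersingularity is a property of `j` over `k̄`.** If `E₁/𝔽_p` is supersingular at every
finite level inside `k` (`p ∣ #K₀ + 1 − #E₁(K₀)` for all finite subfields `K₀`), then every elliptic
curve `V/k` with `j(V) = j(E₁)` has no point of order `p`: `E₁ ⊗ k ≅ V` (Mathlib
`exists_variableChange_of_j_eq`, *AEC* III.1.4(b)) and `baseChange_eq_zero_of_zsmul_eq_zero_of_forall_dvd_trace`.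
[cite: SilvermanAEC2009, Prop. III.1.4(b) and Thm. V.3.1(a)] -/
theorem eq_zero_of_zsmul_eq_zero_of_j_eq_of_forall_dvd_trace [Algebra (ZMod p) k]
    (E₁ : WeierstrassCurve (ZMod p)) [E₁.IsElliptic]
    (hss : ∀ (K₀ : IntermediateField (ZMod p) k) [Finite K₀],
      (p : ℤ) ∣ (Nat.card K₀ : ℤ) + 1 - Nat.card (E₁.baseChange K₀).toAffine.Point)
    (V : WeierstrassCurve k) [V.IsElliptic] (hj : V.j = algebraMap (ZMod p) k E₁.j)
    (Q : V.toAffine.Point) (hQ : (p : ℤ) • Q = 0) : Q = 0 := by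
  have hjk : (E₁.baseChange k).j = V.j := (E₁.map_j (algebraMap (ZMod p) k)).trans hj.symm
  obtain ⟨C, hC⟩ := exists_variableChange_of_j_eq (E₁.baseChange k) V hjk
  set Q₁ : (E₁.baseChange k).toAffine.Point :=
    (VariableChange.pointEquiv (E₁.baseChange k) C).symm ((Affine.Point.congrEquiv hC).symm Q)
    with hQ₁def
  have hQ₁ : (p : ℤ) • Q₁ = 0 := by
    rw [hQ₁def, ← map_zsmul, ← map_zsmul, hQ, map_zero, map_zero]
  have h0 : Q₁ = 0 := baseChange_eq_zero_of_zsmul_eq_zero_of_forall_dvd_trace p E₁ hss Q₁ hQ₁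
  have hQ' : Q = Affine.Point.congrEquiv hC (VariableChange.pointEquiv (E₁.baseChange k) C Q₁) := by
    rw [hQ₁def, AddEquiv.apply_symm_apply, AddEquiv.apply_symm_apply]
  rw [hQ', h0, map_zero, map_zero]

/-- **`j = 0`, `p ≡ 2 (mod 3)`, `p ≥ 5`: no point of order `p` over `k̄`** — every elliptic curve
with `j = 0` over an algebraically closed field of characteristic `p ≥ 5`, `3 ∤ p − 1`, has
`V(k)[p] = 0` (SUPERSINGULAR): Mathlib's `ofJ 0` over `𝔽_p` is supersingular at every finite level
by additive-p2's Deuring converse `SpecialJ.dvd_trace_of_j_eq_zero_of_ringChar_eq` (*AEC* V.4.1(a),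
Ex. V.4.4). [cite: SilvermanAEC2009, Thm. V.4.1(a), Exercise V.4.4, Thm. V.3.1(a), Prop. III.1.4(b)] -/
theorem eq_zero_of_zsmul_eq_zero_of_j_eq_zero [CharP k p] (hp5 : 5 ≤ p) (h3 : ¬ 3 ∣ p - 1)
    (V : WeierstrassCurve k) [V.IsElliptic] (hj : V.j = 0)
    (Q : V.toAffine.Point) (hQ : (p : ℤ) • Q = 0) : Q = 0 := by
  letI : Algebra (ZMod p) k := ZMod.algebra k p
  refine eq_zero_of_zsmul_eq_zero_of_j_eq_of_forall_dvd_trace p (WeierstrassCurve.ofJ 0)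
    (fun K₀ _ ↦ ?_) V (by rw [ofJ_j, map_zero]; exact hj) Q hQ
  haveI : CharP K₀ p := (Algebra.charP_iff (ZMod p) K₀ p).mp inferInstance
  exact SpecialJ.dvd_trace_of_j_eq_zero_of_ringChar_eq ((WeierstrassCurve.ofJ (0 : ZMod p)).baseChange K₀)
    (ringChar.eq_iff.mpr inferInstance) hp5
    (((WeierstrassCurve.ofJ (0 : ZMod p)).map_j (algebraMap (ZMod p) K₀)).trans
      (by rw [ofJ_j, map_zero])) h3

/-- **`j = 1728`, `p ≡ 3 (mod 4)`, `p ≥ 5`: no point of order `p` over `k̄`** (SUPERSINGULAR;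
additive-p2's `SpecialJ.dvd_trace_of_j_eq_of_ringChar_eq`, *AEC* V.4.1(a), Ex. V.4.5, on Mathlib's
`ofJ 1728`). [cite: SilvermanAEC2009, Thm. V.4.1(a), Exercise V.4.5, Thm. V.3.1(a), Prop. III.1.4(b)] -/
theorem eq_zero_of_zsmul_eq_zero_of_j_eq_1728 [CharP k p] (hp5 : 5 ≤ p) (h4 : ¬ 4 ∣ p - 1)
    (V : WeierstrassCurve k) [V.IsElliptic] (hj : V.j = 1728)
    (Q : V.toAffine.Point) (hQ : (p : ℤ) • Q = 0) : Q = 0 := by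
  letI : Algebra (ZMod p) k := ZMod.algebra k p
  refine eq_zero_of_zsmul_eq_zero_of_j_eq_of_forall_dvd_trace p (WeierstrassCurve.ofJ 1728)
    (fun K₀ _ ↦ ?_) V (by rw [ofJ_j, map_ofNat]; exact hj) Q hQ
  haveI : CharP K₀ p := (Algebra.charP_iff (ZMod p) K₀ p).mp inferInstance
  exact SpecialJ.dvd_trace_of_j_eq_of_ringChar_eq ((WeierstrassCurve.ofJ (1728 : ZMod p)).baseChange K₀)
    (ringChar.eq_iff.mpr inferInstance) hp5
    (((WeierstrassCurve.ofJ (1728 : ZMod p)).map_j (algebraMap (ZMod p) K₀)).trans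
      (by rw [ofJ_j, map_ofNat])) h4

end AlgClosed

/-! ## §2 Reduction: a good model with SUPERSINGULAR special-`j` residue has all its `p`-power
torsion in the kernel of reduction -/

section Reduction

variable {L : Type u} [Field L] {Γ₀ : Type*} [LinearOrderedCommGroupWithZero Γ₀] {v : Valuation L Γ₀}
  {O : Type*} [CommRing O] [IsLocalRing O] [Algebra O L] (hv : v.Integers O)
  {M : WeierstrassCurve O} (hΔ : IsUnit M.Δ) (p : ℕ) [hp : Fact p.Prime]

omit hp in
/-- **No `p`-torsion in the reduction ⇒ every `p`-power torsion point reduces to `Õ`.** For a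
Weierstrass equation `M` with unit discriminant over a local ring `O` of integers of a valuation of
`L` (`hv : v.Integers O`): if the reduced
curve `M̃ = M mod 𝔪` has no point of order `p` over `k̄ = AlgebraicClosure (ResidueField O)`, then
`red P = Õ` whenever `p^n • P = O` (`red` is a homomorphism, *AEC* VII.2.1, and
`M̃(k_w) ↪ M̃(k̄)` along the tree's `mapPointHom`). [cite: SilvermanAEC2009, Prop. VII.2.1] -/
theorem goodReductionHom_eq_zero_of_pow_smul_eq_zero_of_forall_map
    (hres : ∀ Q : ((M.map (IsLocalRing.residue O)).map (algebraMap (IsLocalRing.ResidueField O)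
        (AlgebraicClosure (IsLocalRing.ResidueField O)))).toAffine.Point, (p : ℤ) • Q = 0 → Q = 0)
    (P : (M.baseChange L).toAffine.Point) {n : ℕ} (hP : p ^ n • P = 0) :
    goodReductionHom M hv hΔ P = 0 := by
  have hk : ∀ R : (M.map (IsLocalRing.residue O)).toAffine.Point, (p : ℤ) • R = 0 → R = 0 := by
    intro R hR
    apply (M.map (IsLocalRing.residue O)).mapPointHom_injective
      (algebraMap (IsLocalRing.ResidueField O) (AlgebraicClosure (IsLocalRing.ResidueField O)))
    rw [map_zero]
    exact hres _ (by rw [← map_zsmul, hR, map_zero])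
  exact eq_zero_of_pow_nsmul_eq_zero_of_forall hk (n := n) (by rw [← map_nsmul, hP, map_zero])

/-- **A good model with `j̃ = 0` at `p ≡ 2 (mod 3)`, `p ≥ 5`** (semistability defects `e ∈ {3, 6}`
with `e ∤ p − 1`: Kodaira `IV, IV*, II, II*` on the census cell `(t′)`): EVERY `p`-power torsion point
of `M(L)` reduces to `Õ` — the reduced curve is SUPERSINGULAR (§1). This is the hypothesis `htors`
of S1 `not_isTorsion_of_torsion_mem_kernel` (Greenberg, LNM 1716 p. 83: "`C_v = E[p^∞]` since
`Ẽ[p^∞] = 0`"). [cite: SilvermanAEC2009, Thm. V.4.1(a), Exercise V.4.4, Prop. VII.2.1]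
[cite: GreenbergLNM1716, Thm 1.7 (p. 61) and §2 p. 83] -/
theorem goodReductionHom_eq_zero_of_pow_smul_eq_zero_of_residue_c₄_eq_zero
    [CharP (IsLocalRing.ResidueField O) p] (hp5 : 5 ≤ p) (h3 : ¬ 3 ∣ p - 1)
    (hc₄ : IsLocalRing.residue O M.c₄ = 0)
    (P : (M.baseChange L).toAffine.Point) {n : ℕ} (hP : p ^ n • P = 0) :
    goodReductionHom M hv hΔ P = 0 := by
  haveI := isElliptic_map_residue (W := M) hΔ
  haveI : CharP (AlgebraicClosure (IsLocalRing.ResidueField O)) p :=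
    (Algebra.charP_iff (IsLocalRing.ResidueField O) (AlgebraicClosure (IsLocalRing.ResidueField O)) p).mp
      inferInstance
  have hj0 : (M.map (IsLocalRing.residue O)).j = 0 :=
    (M.map (IsLocalRing.residue O)).j_eq_zero (by rw [map_c₄, hc₄])
  have hj : ((M.map (IsLocalRing.residue O)).map (algebraMap (IsLocalRing.ResidueField O)
      (AlgebraicClosure (IsLocalRing.ResidueField O)))).j = 0 := by
    rw [map_j, hj0, map_zero]
  exact goodReductionHom_eq_zero_of_pow_smul_eq_zero_of_forall_map hv hΔ p
    (fun Q hQ ↦ eq_zero_of_zsmul_eq_zero_of_j_eq_zero p hp5 h3 _ hj Q hQ) P hP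

/-- **A good model with `j̃ = 1728` at `p ≡ 3 (mod 4)`, `p ≥ 5`** (defect `e = 4`, `4 ∤ p − 1`:
Kodaira `III, III*` on `(t′)`): every `p`-power torsion point of `M(L)` reduces to `Õ`.
[cite: SilvermanAEC2009, Thm. V.4.1(a), Exercise V.4.5, Prop. VII.2.1]
[cite: GreenbergLNM1716, Thm 1.7 (p. 61) and §2 p. 83] -/
theorem goodReductionHom_eq_zero_of_pow_smul_eq_zero_of_residue_c₆_eq_zero
    [CharP (IsLocalRing.ResidueField O) p] (hp5 : 5 ≤ p) (h4 : ¬ 4 ∣ p - 1)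
    (hc₆ : IsLocalRing.residue O M.c₆ = 0)
    (P : (M.baseChange L).toAffine.Point) {n : ℕ} (hP : p ^ n • P = 0) :
    goodReductionHom M hv hΔ P = 0 := by
  haveI := isElliptic_map_residue (W := M) hΔ
  haveI : CharP (AlgebraicClosure (IsLocalRing.ResidueField O)) p :=
    (Algebra.charP_iff (IsLocalRing.ResidueField O) (AlgebraicClosure (IsLocalRing.ResidueField O)) p).mp
      inferInstance
  have hj0 : (M.map (IsLocalRing.residue O)).j = 1728 :=
    (SpecialJ.j_eq_iff_c₆_eq_zero _).mpr (by rw [map_c₆, hc₆])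
  have hj : ((M.map (IsLocalRing.residue O)).map (algebraMap (IsLocalRing.ResidueField O)
      (AlgebraicClosure (IsLocalRing.ResidueField O)))).j = 1728 := by
    rw [map_j, hj0, map_ofNat]
  exact goodReductionHom_eq_zero_of_pow_smul_eq_zero_of_forall_map hv hΔ p
    (fun Q hQ ↦ eq_zero_of_zsmul_eq_zero_of_j_eq_1728 p hp5 h4 _ hj Q hQ) P hP

end Reduction

end Summit.BirchSwinnertonDyer.Rank1Residual.Additive.GoodModelLine

end
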